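import Mathlib
import Literature.Probability.LatticeModels.ProdBernoulliIndependence
import Literature.Probability.Percolation.PercolationProofs
import HarnessLib

/-!
# Crossing seals: posimodularity of closed-boundary probabilities, and relay isolation

Stubs `stub_crossingSeals` and `stub_crossingSealsIsolation` of line `SketchR2I5` for the crux
`PercNearOneGluing.NearOneGluing` (item stmt-CriticalPhenomena-4574, Kozma–Nitzan Conjecture 3,
typed over all finite weighted graphs).

For `μ = prodBernoulli w` on bond configurations `ω : Set (Sym2 (Fin n))` and a vertex set `X`,
the *seal* of `X` is the event "every pair from `X` to `Xᶜ` is closed".  Its probability is the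
product `∏_{x ∈ X} ∏_{y ∉ X} (1 − w s(x,y))` (`real_seal_eq`, from
`prodBernoulli_real_forall_notMem`: the map `(x, y) ↦ s(x, y)` is injective on `X ×ˢ Xᶜ`).
Writing `Π(X, Y) := ∏_{x ∈ X} ∏_{y ∈ Y} f x y` for a symmetric `f` with values in `[0, 1]`,
`Π(S, Sᶜ) = Π(S∖T, Sᶜ) · Π(S∩T, Sᶜ) ≤ Π(S∖T, Sᶜ) · Π(T∖S, S∩T)` (`T∖S ⊆ Sᶜ`, factors in
`[0,1]` may be dropped, symmetry) and `Π(S∖T, (S∖T)ᶜ) = Π(S∖T, Sᶜ) · Π(S∖T, S∩T)`; with the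
same two facts for `(T, S)` this gives the posimodularity inequality
`Π(S, Sᶜ) Π(T, Tᶜ) ≤ Π(S∖T, (S∖T)ᶜ) Π(T∖S, (T∖S)ᶜ)` (`prod_compl_mul_prod_compl_le`), hence
`μ(seal S) μ(seal T) ≤ μ(seal (S∖T)) μ(seal (T∖S))` (`stub_crossingSeals`).  On `seal X` no open
path leaves `X` (`SimpleGraph.Walk.exists_boundary_dart`), whence the isolation corollary
`stub_crossingSealsIsolation` by monotonicity of the measure.
-/

namespace Summit.CriticalPhenomena.PercolationContinuityZ3.Theorems

open MeasureTheory Set Literature.Probability.LatticeModels Literature.Probability.Percolation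
open scoped Classical BigOperators

section CrossingSeals

variable {n : ℕ}

/-- **Seal probability.** `μ{every pair from X to Xᶜ is closed} = ∏_{x ∈ X} ∏_{y ∈ Xᶜ} (1 − w s(x,y))`
(product measure; each unordered boundary pair is counted once since `(x, y) ↦ s(x, y)` is
injective on `X ×ˢ Xᶜ`). -/
theorem real_seal_eq (w : Sym2 (Fin n) → unitInterval) (X : Finset (Fin n)) :
    (prodBernoulli w).real {ω | ∀ x ∈ X, ∀ y ∉ X, s(x, y) ∉ ω} =
      ∏ x ∈ X, ∏ y ∈ Xᶜ, (1 - (w s(x, y) : ℝ)) := by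
  have hinj : Set.InjOn (fun p : Fin n × Fin n => s(p.1, p.2)) ↑(X ×ˢ Xᶜ) := by
    rintro ⟨x, y⟩ hxy ⟨x', y'⟩ hxy' h
    have h1 := Finset.mem_product.1 (Finset.mem_coe.1 hxy)
    have h2 := Finset.mem_product.1 (Finset.mem_coe.1 hxy')
    have h' : s(x, y) = s(x', y') := h
    rcases Sym2.eq_iff.1 h' with ⟨hx, hy⟩ | ⟨hx, hy⟩
    · rw [hx, hy]
    · exact ((Finset.mem_compl.1 h2.2) (hx ▸ h1.1)).elim
  have hset : {ω : Set (Sym2 (Fin n)) | ∀ x ∈ X, ∀ y ∉ X, s(x, y) ∉ ω} =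
      {ω | ∀ e ∈ (X ×ˢ Xᶜ).image (fun p : Fin n × Fin n => s(p.1, p.2)), e ∉ ω} := by
    ext ω
    simp only [Set.mem_setOf_eq]
    constructor
    · intro h e he
      obtain ⟨⟨x, y⟩, hxy, rfl⟩ := Finset.mem_image.1 he
      have h1 := Finset.mem_product.1 hxy
      exact h x h1.1 y (Finset.mem_compl.1 h1.2)
    · intro h x hx y hy
      exact h _ (Finset.mem_image.2 ⟨(x, y), Finset.mem_product.2 ⟨hx, Finset.mem_compl.2 hy⟩, rfl⟩)
  rw [hset, prodBernoulli_real_forall_notMem, Finset.prod_image hinj, Finset.prod_product]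

/-- One side of posimodularity: `Π(S, Sᶜ) ≤ Π(S∖T, Sᶜ) · Π(T∖S, S∩T)` for a symmetric `f` with
values in `[0, 1]` (split `S = (S∖T) ⊔ (S∩T)`, shrink the inner index set `Sᶜ ⊇ T∖S`, swap). -/
theorem prod_compl_le_mul (f : Fin n → Fin n → ℝ) (hf0 : ∀ x y, 0 ≤ f x y)
    (hf1 : ∀ x y, f x y ≤ 1) (hfs : ∀ x y, f x y = f y x) (S T : Finset (Fin n)) :
    ∏ x ∈ S, ∏ y ∈ Sᶜ, f x y ≤
      (∏ x ∈ S \ T, ∏ y ∈ Sᶜ, f x y) * ∏ x ∈ T \ S, ∏ y ∈ S ∩ T, f x y := by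
  have hsplit : ∏ x ∈ S, ∏ y ∈ Sᶜ, f x y =
      (∏ x ∈ S \ T, ∏ y ∈ Sᶜ, f x y) * ∏ x ∈ S ∩ T, ∏ y ∈ Sᶜ, f x y := by
    rw [← Finset.prod_union (Finset.disjoint_sdiff_inter S T), Finset.sdiff_union_inter]
  rw [hsplit]
  refine mul_le_mul_of_nonneg_left ?_ (Finset.prod_nonneg fun x _ => Finset.prod_nonneg fun y _ => hf0 x y)
  have hsub : T \ S ⊆ Sᶜ := fun y hy => Finset.mem_compl.2 (Finset.mem_sdiff.1 hy).2
  calc ∏ x ∈ S ∩ T, ∏ y ∈ Sᶜ, f x y ≤ ∏ x ∈ S ∩ T, ∏ y ∈ T \ S, f x y :=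
        Finset.prod_le_prod (fun x _ => Finset.prod_nonneg fun y _ => hf0 x y) fun x _ =>
          Finset.prod_le_prod_of_subset_of_le_one hsub (fun y _ => hf0 x y) fun y _ _ => hf1 x y
    _ = ∏ y ∈ T \ S, ∏ x ∈ S ∩ T, f x y := Finset.prod_comm
    _ = ∏ x ∈ T \ S, ∏ y ∈ S ∩ T, f x y :=
        Finset.prod_congr rfl fun y _ => Finset.prod_congr rfl fun x _ => hfs x y

/-- The other bookkeeping identity: `Π(S∖T, (S∖T)ᶜ) = Π(S∖T, Sᶜ) · Π(S∖T, S∩T)`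
(`(S∖T)ᶜ = Sᶜ ⊔ (S∩T)`). -/
theorem prod_compl_sdiff_eq (f : Fin n → Fin n → ℝ) (S T : Finset (Fin n)) :
    ∏ x ∈ S \ T, ∏ y ∈ (S \ T)ᶜ, f x y =
      (∏ x ∈ S \ T, ∏ y ∈ Sᶜ, f x y) * ∏ x ∈ S \ T, ∏ y ∈ S ∩ T, f x y := by
  have hc : (S \ T)ᶜ = Sᶜ ∪ S ∩ T := by
    ext y
    simp only [Finset.mem_compl, Finset.mem_sdiff, Finset.mem_union, Finset.mem_inter]
    tauto
  have hd : Disjoint Sᶜ (S ∩ T) :=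
    Finset.disjoint_left.2 fun y hy hy' => Finset.mem_compl.1 hy (Finset.mem_inter.1 hy').1
  rw [hc, ← Finset.prod_mul_distrib]
  exact Finset.prod_congr rfl fun x _ => Finset.prod_union hd

/-- **Posimodularity of double products with factors in `[0, 1]`.**
`Π(S, Sᶜ) Π(T, Tᶜ) ≤ Π(S∖T, (S∖T)ᶜ) Π(T∖S, (T∖S)ᶜ)` for symmetric `f` with `0 ≤ f ≤ 1`. -/
theorem prod_compl_mul_prod_compl_le (f : Fin n → Fin n → ℝ) (hf0 : ∀ x y, 0 ≤ f x y)
    (hf1 : ∀ x y, f x y ≤ 1) (hfs : ∀ x y, f x y = f y x) (S T : Finset (Fin n)) :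
    (∏ x ∈ S, ∏ y ∈ Sᶜ, f x y) * ∏ x ∈ T, ∏ y ∈ Tᶜ, f x y ≤
      (∏ x ∈ S \ T, ∏ y ∈ (S \ T)ᶜ, f x y) * ∏ x ∈ T \ S, ∏ y ∈ (T \ S)ᶜ, f x y := by
  have hnn : ∀ X Y : Finset (Fin n), 0 ≤ ∏ x ∈ X, ∏ y ∈ Y, f x y := fun X Y =>
    Finset.prod_nonneg fun x _ => Finset.prod_nonneg fun y _ => hf0 x y
  have hS := prod_compl_le_mul f hf0 hf1 hfs S T
  have hT := prod_compl_le_mul f hf0 hf1 hfs T S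
  rw [Finset.inter_comm T S] at hT
  rw [prod_compl_sdiff_eq f S T, prod_compl_sdiff_eq f T S, Finset.inter_comm T S]
  calc (∏ x ∈ S, ∏ y ∈ Sᶜ, f x y) * ∏ x ∈ T, ∏ y ∈ Tᶜ, f x y ≤
        ((∏ x ∈ S \ T, ∏ y ∈ Sᶜ, f x y) * ∏ x ∈ T \ S, ∏ y ∈ S ∩ T, f x y) *
          ((∏ x ∈ T \ S, ∏ y ∈ Tᶜ, f x y) * ∏ x ∈ S \ T, ∏ y ∈ S ∩ T, f x y) :=
        mul_le_mul hS hT (hnn _ _) (mul_nonneg (hnn _ _) (hnn _ _))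
    _ = ((∏ x ∈ S \ T, ∏ y ∈ Sᶜ, f x y) * ∏ x ∈ S \ T, ∏ y ∈ S ∩ T, f x y) *
          ((∏ x ∈ T \ S, ∏ y ∈ Tᶜ, f x y) * ∏ x ∈ T \ S, ∏ y ∈ S ∩ T, f x y) := by ring

/-- **On the seal of `X` no open path leaves `X`**: if every pair from `X` to `Xᶜ` is closed and
`a ∈ X`, then `a ↮ z` for every `z ∉ X` (an open walk from `a` to `z` has a boundary dart,
`SimpleGraph.Walk.exists_boundary_dart`, whose pair would be open). -/
theorem seal_subset_forall_notMem_openConn (X : Finset (Fin n)) {a : Fin n} (ha : a ∈ X) :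
    {ω : Set (Sym2 (Fin n)) | ∀ x ∈ X, ∀ y ∉ X, s(x, y) ∉ ω} ⊆ {ω | ∀ z ∉ X, ω ∉ openConn a z} := by
  intro ω hω z hz hconn
  obtain ⟨p⟩ : (openGraph ω).Reachable a z := hconn
  obtain ⟨d, -, hd1, hd2⟩ :=
    p.exists_boundary_dart (↑X) (Finset.mem_coe.2 ha) (fun h => hz (Finset.mem_coe.1 h))
  exact hω d.fst (Finset.mem_coe.1 hd1) d.snd (fun h => hd2 (Finset.mem_coe.2 h))
    ((openGraph_adj ω _ _).1 d.adj).1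

end CrossingSeals

/-- **Crossing seals (posimodularity of closed-boundary probabilities).**  For vertex sets `S, T`
of a finite weighted graph the events "every pair from `X` to `Xᶜ` is closed" satisfy
`μ(seal S) · μ(seal T) ≤ μ(seal (S ∖ T)) · μ(seal (T ∖ S))` under `μ = prodBernoulli w`.
Proof: `μ(seal X) = ∏_{x ∈ X} ∏_{y ∉ X} (1 − w s(x,y))` (`real_seal_eq`) and posimodularity of
such double products (`prod_compl_mul_prod_compl_le`, with `f x y = 1 − w s(x,y) ∈ [0,1]`
symmetric by `Sym2.eq_swap`). -/
theorem stub_crossingSeals :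
    ∀ (n : ℕ) (w : Sym2 (Fin n) → unitInterval) (S T : Finset (Fin n)),
      (prodBernoulli w).real {ω | ∀ x ∈ S, ∀ y ∉ S, s(x, y) ∉ ω} *
          (prodBernoulli w).real {ω | ∀ x ∈ T, ∀ y ∉ T, s(x, y) ∉ ω} ≤
        (prodBernoulli w).real {ω | ∀ x ∈ S \ T, ∀ y ∉ S \ T, s(x, y) ∉ ω} *
          (prodBernoulli w).real {ω | ∀ x ∈ T \ S, ∀ y ∉ T \ S, s(x, y) ∉ ω} := by
  intro n w S T
  rw [real_seal_eq, real_seal_eq, real_seal_eq, real_seal_eq]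
  exact prod_compl_mul_prod_compl_le (fun x y => 1 - (w s(x, y) : ℝ))
    (fun x y => sub_nonneg.2 (w s(x, y)).2.2) (fun x y => sub_le_self _ (w s(x, y)).2.1)
    (fun x y => by rw [Sym2.eq_swap]) S T

/-- **Crossing seals pay relay isolation.**  If `a ∈ S ∖ T` and `a' ∈ T ∖ S` then
`μ(seal S) · μ(seal T) ≤ μ(a ↮ z for all z ∉ S ∖ T) · μ(a' ↮ z for all z ∉ T ∖ S)`: by
`stub_crossingSeals` and the inclusions `seal (S ∖ T) ⊆ {C(a) ⊆ S ∖ T}`,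
`seal (T ∖ S) ⊆ {C(a') ⊆ T ∖ S}` (`seal_subset_forall_notMem_openConn`: on the seal of `X` no open
path leaves `X`), monotonicity of the measure and `mul_le_mul`. -/
theorem stub_crossingSealsIsolation :
    ∀ (n : ℕ) (w : Sym2 (Fin n) → unitInterval) (S T : Finset (Fin n)) (a a' : Fin n),
      a ∈ S \ T → a' ∈ T \ S →
      (prodBernoulli w).real {ω | ∀ x ∈ S, ∀ y ∉ S, s(x, y) ∉ ω} *
          (prodBernoulli w).real {ω | ∀ x ∈ T, ∀ y ∉ T, s(x, y) ∉ ω} ≤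
        (prodBernoulli w).real {ω | ∀ z ∉ S \ T, ω ∉ openConn a z} *
          (prodBernoulli w).real {ω | ∀ z ∉ T \ S, ω ∉ openConn a' z} := by
  intro n w S T a a' ha ha'
  refine (stub_crossingSeals n w S T).trans ?_
  exact mul_le_mul
    (measureReal_mono (seal_subset_forall_notMem_openConn (S \ T) ha) (measure_ne_top _ _))
    (measureReal_mono (seal_subset_forall_notMem_openConn (T \ S) ha') (measure_ne_top _ _))
    measureReal_nonneg measureReal_nonneg

end Summit.CriticalPhenomena.PercolationContinuityZ3.Theorems
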